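import Literature.AlgebraicGeometry.Resolution.InseparableLocalUniformizationLemmas
import Mathlib.RingTheory.Smooth.NoetherianDescent
import Mathlib.RingTheory.Smooth.IntegralClosure
import Mathlib.RingTheory.Polynomial.Subring
import Mathlib.RingTheory.Flat.Basic
import Mathlib.Data.Finset.Order
import HarnessLib

/-!
# Inseparable local uniformization: proof of Lemma 2.8.4 "⇒" (Temkin 2013)

Topic: `Literature/AlgebraicGeometry/Resolution`. Sibling proof file of
`InseparableLocalUniformizationLemmas.lean`: it DISCHARGES the named fact `Temkin2013_Lemma284`
— M. Temkin, *Inseparable local uniformization*, J. Algebra 373 (2013) 65–119 =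
arXiv:0804.1554v3, **Lemma 2.8.4**, direction "⇒" (smooth-equivalence over the limit base
`S = Spec R₀`, `R₀ = ⋃ B_α`, descends to smooth-equivalence over `S_α = Spec B_α` for all large
`α`), in the affine rendering of its use in §4 (`etaModel`, `AreSmoothEquivalent`).

* `Temkin2013_Lemma284_holds : Temkin2013_Lemma284` — PROVED.

The printed proof (p. 31 of v3; Lemma 2.7.4, p. 19 of the earlier arXiv version held in the
literature store): "Find `z ∈ Z` and smooth morphisms `f : Z → Y` and `g : Z → X` as in
definition 2.8.1. By Proposition 2.3.8, `f` and `g` come from smooth morphisms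
`f_α : Z_α → Y_α` and `g_α : Z_α → X_α` for sufficiently large `α`, and it is obvious that `x_α`
and `y_α` are the images of the projection `z_α ∈ Z_α` of `z`." Prop. 2.3.8 is the
`η`-normalized version of EGA IV₃ §8 (limits of schemes, descent of morphisms and of
smoothness); its part (iv) is only asserted in print ("We deduce the Proposition from its analog
in [EGA]"). The formalization works inside the given affine smooth cover `Z = Spec D` of
`(X, x)` and `(Y, y)` and replaces the `η`-normalized base changes `Z_α` by explicit level
subrings of `D`:

* `exists_mem_nrIn_of_directed`, `exists_mem_etaModel_of_directed` — `Nr_K` commutes with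
  directed unions, so `X = Nr_K(C·R₀) = ⋃_α X_α`, `X_α = Nr_K(C·B_α)` (the affine content of
  Prop. 2.3.8 (i)).
* `exists_levelSubring_smooth` — ONE-SIDED LIMIT DESCENT of the smooth cover: by Mathlib's
  Noetherian descent of smooth algebras (`Algebra.Smooth.exists_subalgebra_fg`, after
  EGA IV₄ 17.7.8) `D ≅ X ⊗_{A₀} D₀` with `A₀ ⊆ X` finitely generated and `D₀` smooth over `A₀`;
  for `α` large `A₀ ⊆ X_α`, and the level subring `E_α = ℤ[X_α, F] ⊆ D` (`F` = the
  images of generators of `D₀`) is the isomorphic image of the smooth `X_α`-algebra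
  `X_α ⊗_{A₀} D₀` (injectivity by flatness), the `E_α` exhaust `D`, and each `E_α` is
  INTEGRALLY CLOSED in `D` — smooth base change commutes with integral closure (Stacks 03GE,
  Mathlib `TensorProduct.toIntegralClosure_bijective_of_smooth`; this replaces Lemma 2.3.9
  (iii), "smooth over `η`-normal is `η`-normal").
* assembly (`Temkin2013_Lemma284_holds`): applying this to `X = ⋃ X_α` and to `Y = ⋃ Y_α`
  gives level subrings `E_α`, `E′_α` of `D`; for `α` large each contains the other's finitely
  many extra generators and the image of the other model (`Y_α` is integral over `C′·B_α`,
  whose image lies in `E_α` because the two `R₀`-structures of `D` agree —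
  `forall_mem_of_etaModel`), so `E_α = E′_α =: Z_α` is smooth over both `X_α` and `Y_α`,
  compatibly over `B_α`, and `z_α = z ∩ Z_α` lies over `x_α` and `y_α`.

The hypotheses "`B_{α₀}` Noetherian", "`Frac B_α = κ`" and "`κ[C]`, `κ[C′]` integrally closed"
of the fact are not needed for this direction.

## Sources

* M. Temkin, *Inseparable local uniformization*, J. Algebra 373 (2013) 65–119 =
  arXiv:0804.1554v3: Situation 2.3.7, Prop. 2.3.8, Lemma 2.3.9 (pp. 14–15); Definition 2.8.1,
  Lemma 2.8.4 (pp. 29–31). (Earlier arXiv version: Situation 2.2.7, Prop. 2.2.8, Lemma 2.2.9,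
  pp. 8–9; Definition 2.7.1, Lemma 2.7.4, pp. 18–19.) [Temkin2013]
* A. Grothendieck, EGA IV₃ Thm. 8.8.2, IV₄ Prop. 17.7.8 (limit descent), via Mathlib
  `Mathlib.RingTheory.Smooth.NoetherianDescent`.
* The Stacks Project, Tag 03GE (smooth base change commutes with integral closure), via Mathlib
  `Mathlib.RingTheory.Smooth.IntegralClosure`.
-/

noncomputable section

open Polynomial TensorProduct

namespace Literature.AlgebraicGeometry.Resolution

universe u

/-! ### Directed families: finite sets and integral closures -/

section directed

variable {ι : Type*} [Preorder ι] [IsDirectedOrder ι] [Nonempty ι]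

/-- In a directed family of conditions increasing with the index, finitely many conditions each
met at some index are met simultaneously at one index. [folklore] -/
theorem exists_forall_finset_of_directed {α : Type*} (P : ι → α → Prop)
    (hP : ∀ ⦃i j⦄, i ≤ j → ∀ a, P i a → P j a) (s : Finset α) (h : ∀ a ∈ s, ∃ i, P i a) :
    ∃ i, ∀ a ∈ s, P i a := by
  classical
  induction s using Finset.induction_on with
  | empty => exact ⟨Classical.arbitrary ι, fun a ha => absurd ha (Finset.notMem_empty a)⟩
  | insert a s _ ih =>
    obtain ⟨i, hi⟩ := ih fun b hb => h b (Finset.mem_insert_of_mem hb)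
    obtain ⟨j, hj⟩ := h a (Finset.mem_insert_self a s)
    obtain ⟨k, hik, hjk⟩ := exists_ge_ge i j
    refine ⟨k, fun b hb => ?_⟩
    rcases Finset.mem_insert.mp hb with rfl | hb
    · exact hP hjk _ hj
    · exact hP hik _ (hi b hb)

variable {K : Type*} [Field K]

/-- **`Nr_K` commutes with directed unions**: an element of `K` integral over a directed union
`S ⊆ ⋃ Tᵢ` of subrings is integral over one `Tᵢ` (a monic equation has finitely many
coefficients) — the affine content of Temkin 2013, Prop. 2.3.8 (i) ("the subring `Nr_{A_η}(A)`
of `A_η` is the filtered union of the subrings `Nr_{A_{α,η}}(A_α)`"). [folklore] -/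
theorem exists_mem_nrIn_of_directed (T : ι → Subring K) (hT : Monotone T) (S : Subring K)
    (hS : ∀ x ∈ S, ∃ i, x ∈ T i) {z : K} (hz : z ∈ nrIn S) : ∃ i, z ∈ nrIn (T i) := by
  classical
  obtain ⟨p, hpm, hpz⟩ := mem_nrIn_iff.mp hz
  obtain ⟨i, hi⟩ := exists_forall_finset_of_directed (fun i (c : S) => (c : K) ∈ T i)
    (fun i j hij c hc => hT hij hc) p.coeffs (fun c _ => hS c c.2)
  refine ⟨i, ?_⟩
  set p' : K[X] := p.map S.subtype with hp'
  have hcoeffs : (↑p'.coeffs : Set K) ⊆ T i := by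
    intro c hc
    obtain ⟨n, -, rfl⟩ := Polynomial.mem_coeffs_iff.mp hc
    rw [hp', Polynomial.coeff_map]
    by_cases hn : p.coeff n = 0
    · rw [hn, map_zero]; exact zero_mem _
    · exact hi _ (Polynomial.coeff_mem_coeffs hn)
  refine mem_nrIn_iff.mpr ⟨p'.toSubring (T i) hcoeffs,
    (Polynomial.monic_toSubring _ _ _).mpr (hpm.map _), ?_⟩
  have h1 : (p'.toSubring (T i) hcoeffs).map (T i).subtype = p' := Polynomial.map_toSubring _ _ _
  calc eval₂ (algebraMap (T i) K) z (p'.toSubring (T i) hcoeffs)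
      = eval z ((p'.toSubring (T i) hcoeffs).map (T i).subtype) := by
        rw [Polynomial.eval_map]; rfl
    _ = eval z p' := by rw [h1]
    _ = eval₂ (algebraMap S K) z p := by rw [hp', Polynomial.eval_map]; rfl
    _ = 0 := hpz

end directed

/-! ### Smooth algebras: integral closure of the base, transport to an isomorphic subring -/

/-- **Smooth base change commutes with integral closure**, degenerate case (Stacks 03GE, Mathlib
`TensorProduct.toIntegralClosure_bijective_of_smooth`): if `S` is smooth over `R` and `R` is
integrally closed in `B`, then `S = S ⊗_R R` is integrally closed in `S ⊗_R B`.
[cite: StacksProject, Tag 03GE] -/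
theorem tmul_one_of_isIntegral {R S B : Type*} [CommRing R] [CommRing S] [Algebra R S]
    [CommRing B] [Algebra R B] [Algebra.Smooth R S]
    (hRB : ∀ b : B, IsIntegral R b → ∃ r : R, algebraMap R B r = b)
    {z : S ⊗[R] B} (hz : IsIntegral S z) : ∃ s : S, s ⊗ₜ[R] (1 : B) = z := by
  obtain ⟨w, hw⟩ :=
    (TensorProduct.toIntegralClosure_bijective_of_smooth (R := R) (S := S) (B := B)).2 ⟨z, hz⟩
  have hw' : Algebra.TensorProduct.map (AlgHom.id S S) (integralClosure R B).val w = z :=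
    congrArg Subtype.val hw
  rw [← hw']
  clear hw hw'
  induction w with
  | zero => exact ⟨0, by simp⟩
  | tmul s c =>
    obtain ⟨r, hr⟩ := hRB c c.2
    refine ⟨r • s, ?_⟩
    rw [Algebra.TensorProduct.map_tmul, AlgHom.id_apply, Subalgebra.coe_val, ← hr,
      Algebra.algebraMap_eq_smul_one, ← TensorProduct.smul_tmul]
  | add x y hx hy =>
    obtain ⟨s, hs⟩ := hx
    obtain ⟨t, ht⟩ := hy
    exact ⟨s + t, by rw [TensorProduct.add_tmul, hs, ht, map_add]⟩

/-- A subring `E ⊆ D` which is the isomorphic image of a smooth `R`-algebra `S`, compatibly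
with a given `j : R → D`, is a smooth `R`-algebra for the structure induced by `j`.
[folklore] -/
theorem exists_algebra_smooth_of_range {R S D : Type*} [CommRing R] [CommRing S] [CommRing D]
    [Algebra R S] [Algebra.Smooth R S] (j : R →+* D) (φ : S →+* D) (hφ : Function.Injective φ)
    (hcomp : φ.comp (algebraMap R S) = j) (E : Subring D) (hE : φ.range = E) :
    ∃ _ : Algebra R E, (∀ r, ((algebraMap R E r : E) : D) = j r) ∧ Algebra.Smooth R E := by
  have hmem : ∀ s, φ s ∈ E := fun s => hE ▸ ⟨s, rfl⟩
  have hj : ∀ r, j r ∈ E := fun r => hcomp ▸ hmem _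
  letI : Algebra R E := (j.codRestrict E hj).toAlgebra
  refine ⟨this, fun r => rfl, ?_⟩
  let f : S →ₐ[R] E :=
    { toRingHom := φ.codRestrict E hmem
      commutes' := fun r => Subtype.ext (RingHom.congr_fun hcomp r) }
  have hf : Function.Bijective f := by
    refine ⟨fun a b h => hφ (congrArg Subtype.val h), fun e => ?_⟩
    have he : (e : D) ∈ φ.range := by rw [hE]; exact e.2
    obtain ⟨s, hs⟩ := he
    exact ⟨s, Subtype.ext hs⟩
  exact Algebra.Smooth.of_equiv (AlgEquiv.ofBijective f hf)

/-- Absorption: if `E ⊆ D` is integrally closed in `D`, `Yᵢ ⊆ M` is integral over a subring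
`T ⊆ Yᵢ`, and `g : Yᵢ → D` maps `T` into `E`, then `g` maps `Yᵢ` into `E`. [folklore] -/
theorem forall_mem_of_isIntegral_of_le {M D : Type*} [Field M] [CommRing D]
    (Yi T : Subring M) (hT : T ≤ Yi) (hint : ∀ y ∈ Yi, IsIntegral T y)
    (g : Yi →+* D) (E : Subring D) (hE : ∀ d, IsIntegral E d → d ∈ E)
    (hgen : ∀ t (ht : t ∈ T), g ⟨t, hT ht⟩ ∈ E) (y : Yi) : g y ∈ E := by
  let φ : T →+* E := (g.comp (Subring.inclusion hT)).codRestrict E (fun t => hgen t t.2)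
  letI : Algebra T Yi := (Subring.inclusion hT).toAlgebra
  haveI : IsScalarTower T Yi M := IsScalarTower.of_algebraMap_eq (fun _ => rfl)
  have hy : IsIntegral T y :=
    (isIntegral_algHom_iff (IsScalarTower.toAlgHom T Yi M) Subtype.val_injective).mp (hint y y.2)
  exact hE _ (IsIntegral.map_of_comp_eq φ g (RingHom.ext fun _ => rfl) hy)

/-! ### The one-sided limit descent of a smooth cover -/

section osc

variable {K : Type u} [Field K] {ι : Type*} [Preorder ι] [IsDirectedOrder ι] [Nonempty ι]

/-- **One-sided limit descent of a smooth cover.** Let `X = ⋃ᵢ Xᵢ ⊆ K` be a directed union of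
subrings, each `Xᵢ` integrally closed in `K`, and `D` a smooth `X`-algebra. Then there are a
level `i₁` and a finite `F ⊆ D` such that the level subrings `Eᵢ = ℤ[Xᵢ, F] ⊆ D` (`i ≥ i₁`)
exhaust `D`, are integrally closed in `D`, and `Eᵢ` is the isomorphic image, compatibly with
`Xᵢ → X → D`, of a smooth `Xᵢ`-algebra — namely of `Xᵢ ⊗_{A₀} D₀` for a Noetherian model
`D ≅ X ⊗_{A₀} D₀`, `A₀ ⊆ X_{i₁}` finitely generated (Mathlib `Algebra.Smooth.exists_subalgebra_fg`,
after EGA IV₃ 8.8.2 / IV₄ 17.7.8), injectivity by flatness, integral closedness by smooth base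
change of integral closure (Stacks 03GE, `tmul_one_of_isIntegral`). This is the affine content,
for the cover `Z = Spec D → X`, of Temkin 2013, Prop. 2.3.8 (iii) ("If an `η`-normal scheme `Z`
is of `η`-normalized finite presentation over `S` then there exists `α ∈ A` such that `Z` is
`S`-isomorphic to the `η`-normalized base change of an `S_α`-scheme `Z̄_α` of finite
presentation") and Lemma 2.3.9 (iii)/(iv) (`η`-normality and smoothness of the levels).
[cite: Temkin2013, Prop. 2.3.8 (iii) and Lemma 2.3.9 (iii)-(iv)] -/
theorem exists_levelSubring_smooth (X : Subring K) (Xf : ι → Subring K)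
    (hle : ∀ i, Xf i ≤ X) (D : Type u) [CommRing D] [Algebra X D] [Algebra.Smooth X D]
    (hmono : Monotone Xf) (hcov : ∀ z ∈ X, ∃ i, z ∈ Xf i)
    (hic : ∀ i, ∀ z : K, IsIntegral (Xf i) z → z ∈ Xf i) :
    ∃ (i₁ : ι) (F : Finset D) (E : ι → Subring D),
      (∀ i, E i = Subring.closure
        (Set.range (fun x : Xf i => algebraMap X D (Subring.inclusion (hle i) x)) ∪ ↑F)) ∧
      (∀ i j, i ≤ j → E i ≤ E j) ∧
      (∀ d : D, ∃ i, i₁ ≤ i ∧ d ∈ E i) ∧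
      (∀ i, i₁ ≤ i → ∀ d : D, IsIntegral (E i) d → d ∈ E i) ∧
      (∀ i, i₁ ≤ i → ∃ (S : Type u) (_ : CommRing S) (_ : Algebra (Xf i) S)
        (_ : Algebra.Smooth (Xf i) S) (φ : S →+* D),
          Function.Injective φ ∧ φ.range = E i ∧
          φ.comp (algebraMap (Xf i) S) = (algebraMap X D).comp (Subring.inclusion (hle i))) := by
  classical
  obtain ⟨A₀, D₀, _, _, hfg, hsm, ⟨e⟩⟩ := Algebra.Smooth.exists_subalgebra_fg ℤ X D
  haveI := hsm
  obtain ⟨t, ht⟩ := hfg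
  obtain ⟨u, hu⟩ := (Algebra.FiniteType.out : (⊤ : Subalgebra A₀ D₀).FG)
  -- a level from which on the generators of `A₀` lie in `X_i`
  obtain ⟨i₁, hi₁⟩ := exists_forall_finset_of_directed (fun i (a : X) => (a : K) ∈ Xf i)
    (fun i j hij a ha => hmono hij ha) t (fun a _ => hcov a a.2)
  have hA₀ : ∀ i, i₁ ≤ i → ∀ a : X, a ∈ A₀ → (a : K) ∈ Xf i := by
    intro i hi a ha
    rw [← ht, Algebra.mem_adjoin_iff] at ha
    have hsub : Set.range (algebraMap ℤ X) ∪ ↑t ⊆ ((Xf i).comap X.subtype : Set X) := by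
      rintro b (⟨n, rfl⟩ | hb)
      · rw [SetLike.mem_coe, Subring.mem_comap, eq_intCast, map_intCast]
        exact intCast_mem (Xf i) n
      · exact hmono hi (hi₁ b hb)
    exact Subring.closure_le.mpr hsub ha
  -- the finite set `F`: images of `A₀`-algebra generators of `D₀`
  let F : Finset D := u.image (fun d => e.symm ((1 : X) ⊗ₜ[A₀] d))
  -- the level subrings `E_i = ℤ[X_i, F]`
  let E : ι → Subring D := fun i => Subring.closure
    (Set.range (fun x : Xf i => algebraMap X D (Subring.inclusion (hle i) x)) ∪ ↑F)
  have hIm : ∀ i (x : Xf i), algebraMap X D (Subring.inclusion (hle i) x) ∈ E i :=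
    fun i x => Subring.subset_closure (Or.inl ⟨x, rfl⟩)
  have hFE : ∀ i, ∀ d ∈ F, d ∈ E i := fun i d hd => Subring.subset_closure (Or.inr hd)
  have hEmono : ∀ {i j}, i ≤ j → E i ≤ E j := fun {i j} hij =>
    Subring.closure_mono (Set.union_subset_union_left _ (by
      rintro _ ⟨x, rfl⟩
      exact ⟨⟨x, hmono hij x.2⟩, rfl⟩))
  -- `e⁻¹ (1 ⊗ d₀) ∈ E_i` for `i ≥ i₁`
  have h1tmul : ∀ i, i₁ ≤ i → ∀ d₀ : D₀,
      e.symm ((1 : X) ⊗ₜ[A₀] d₀) ∈ E i := by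
    intro i hi d₀
    have hd₀ : d₀ ∈ Algebra.adjoin A₀ (↑u : Set D₀) := by rw [hu]; trivial
    induction hd₀ using Algebra.adjoin_induction with
    | mem d hd => exact hFE i _ (Finset.mem_image_of_mem _ hd)
    | algebraMap a =>
      have h1 : (1 : X) ⊗ₜ[A₀] algebraMap A₀ D₀ a = algebraMap X (X ⊗[A₀] D₀) (a : X) := by
        rw [Algebra.TensorProduct.algebraMap_apply, Algebra.algebraMap_self, RingHom.id_apply,
          Algebra.algebraMap_eq_smul_one, ← TensorProduct.smul_tmul, Algebra.smul_def, mul_one]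
        rfl
      rw [h1, AlgEquiv.commutes]
      have h2 : algebraMap X D (a : X) =
          algebraMap X D (Subring.inclusion (hle i) ⟨(a : X), hA₀ i hi a a.2⟩) := rfl
      rw [h2]
      exact hIm i _
    | add x y _ _ hx hy => rw [TensorProduct.tmul_add, map_add]; exact add_mem hx hy
    | mul x y _ _ hx hy =>
      rw [show (1 : X) ⊗ₜ[A₀] (x * y) = ((1 : X) ⊗ₜ[A₀] x) * ((1 : X) ⊗ₜ[A₀] y) by
        rw [Algebra.TensorProduct.tmul_mul_tmul, one_mul], map_mul]
      exact mul_mem hx hy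
  have hxtmul : ∀ (x : X) (d₀ : D₀),
      e.symm (x ⊗ₜ[A₀] d₀) = algebraMap X D x * e.symm ((1 : X) ⊗ₜ[A₀] d₀) := by
    intro x d₀
    rw [← Algebra.smul_def, ← map_smul, TensorProduct.smul_tmul', smul_eq_mul, mul_one]
  -- exhaustion: `D = ⋃ E_i`
  have hcovE : ∀ d : D, ∃ i, i₁ ≤ i ∧ d ∈ E i := by
    intro d
    obtain ⟨w, rfl⟩ : ∃ w, e.symm w = d := ⟨e d, e.symm_apply_apply d⟩
    induction w with
    | zero => exact ⟨i₁, le_rfl, by rw [map_zero]; exact zero_mem _⟩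
    | tmul x d₀ =>
      obtain ⟨i, hi⟩ := hcov x x.2
      obtain ⟨j, hij, hi₁j⟩ := exists_ge_ge i i₁
      refine ⟨j, hi₁j, ?_⟩
      rw [hxtmul]
      refine mul_mem ?_ (h1tmul j hi₁j d₀)
      have : algebraMap X D x = algebraMap X D (Subring.inclusion (hle j) ⟨x, hmono hij hi⟩) :=
        rfl
      rw [this]
      exact hIm j _
    | add w₁ w₂ h₁ h₂ =>
      obtain ⟨i, hi₁, hi⟩ := h₁
      obtain ⟨j, -, hj⟩ := h₂
      obtain ⟨k, hik, hjk⟩ := exists_ge_ge i j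
      exact ⟨k, hi₁.trans hik, by rw [map_add]; exact add_mem (hEmono hik hi) (hEmono hjk hj)⟩
  -- the per-level construction `E_i ≅ X_i ⊗_{A₀} D₀`
  have main : ∀ i, i₁ ≤ i →
      (∀ d : D, IsIntegral (E i) d →
        d ∈ E i) ∧
      ∃ (S : Type u) (_ : CommRing S) (_ : Algebra (Xf i) S) (_ : Algebra.Smooth (Xf i) S)
        (φ : S →+* D), Function.Injective φ ∧ φ.range = E i ∧
          φ.comp (algebraMap (Xf i) S) = (algebraMap X D).comp (Subring.inclusion (hle i)) := by
    intro i hi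
    -- base rings and structures: `A₀ → X_i → X → D`
    letI : Algebra (Xf i) X := (Subring.inclusion (hle i)).toAlgebra
    letI : Algebra (Xf i) D := ((algebraMap X D).comp (Subring.inclusion (hle i))).toAlgebra
    haveI : IsScalarTower (Xf i) X D := IsScalarTower.of_algebraMap_eq (fun _ => rfl)
    haveI : IsScalarTower (Xf i) X K := IsScalarTower.of_algebraMap_eq (fun _ => rfl)
    let fA : A₀ →+* Xf i :=
      (X.subtype.comp (algebraMap A₀ X)).codRestrict (Xf i) (fun a => hA₀ i hi a a.2)
    letI : Algebra A₀ (Xf i) := fA.toAlgebra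
    haveI : IsScalarTower A₀ (Xf i) X := IsScalarTower.of_algebraMap_eq (fun a => Subtype.ext rfl)
    haveI : IsScalarTower A₀ (Xf i) D := IsScalarTower.of_algebraMap_eq (fun _ => rfl)
    -- `ψ : (X_i ⊗_{A₀} D₀) ⊗_{X_i} X ≅ X ⊗_{A₀} D₀ ≅ D` and `φ = ψ ∘ includeLeft`
    let ψ : (Xf i ⊗[A₀] D₀) ⊗[Xf i] X ≃ₐ[Xf i] D :=
      (Algebra.TensorProduct.comm (Xf i) (Xf i ⊗[A₀] D₀) X).trans
        (((Algebra.TensorProduct.cancelBaseChange A₀ (Xf i) X X D₀).restrictScalars (Xf i)).trans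
          (e.symm.restrictScalars (Xf i)))
    let φ : (Xf i ⊗[A₀] D₀) →ₐ[Xf i] D :=
      ψ.toAlgHom.comp
        (Algebra.TensorProduct.includeLeft (S := Xf i) (R := Xf i) (A := Xf i ⊗[A₀] D₀) (B := X))
    have hφ : ∀ (r : Xf i) (d₀ : D₀), φ (r ⊗ₜ[A₀] d₀) =
        algebraMap X D (Subring.inclusion (hle i) r) * e.symm ((1 : X) ⊗ₜ[A₀] d₀) := by
      intro r d₀
      change ψ ((r ⊗ₜ[A₀] d₀) ⊗ₜ[Xf i] (1 : X)) = _
      simp only [ψ, AlgEquiv.trans_apply, Algebra.TensorProduct.comm_tmul,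
        AlgEquiv.restrictScalars_apply, Algebra.TensorProduct.cancelBaseChange_tmul]
      rw [Algebra.smul_def, mul_one, hxtmul]
      rfl
    have hrange : φ.toRingHom.range = E i := by
      apply le_antisymm
      · rintro _ ⟨w, rfl⟩
        induction w using TensorProduct.induction_on with
        | zero => change φ 0 ∈ _; rw [map_zero]; exact zero_mem _
        | tmul r d₀ =>
          change φ (r ⊗ₜ[A₀] d₀) ∈ _
          rw [hφ]
          exact mul_mem (hIm i r) (h1tmul i hi d₀)
        | add w₁ w₂ h₁ h₂ =>
          change φ (w₁ + w₂) ∈ _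
          rw [map_add]; exact add_mem h₁ h₂
      · refine Subring.closure_le.mpr ?_
        rintro d (⟨r, rfl⟩ | hd)
        · exact ⟨algebraMap (Xf i) (Xf i ⊗[A₀] D₀) r, φ.commutes r⟩
        · obtain ⟨d₀, -, rfl⟩ := Finset.mem_image.mp (Finset.mem_coe.mp hd)
          refine ⟨(1 : Xf i) ⊗ₜ[A₀] d₀, ?_⟩
          change φ ((1 : Xf i) ⊗ₜ[A₀] d₀) = _
          rw [hφ, map_one, map_one, one_mul]
    have hmemφ : ∀ s, φ s ∈ E i := fun s => hrange ▸ ⟨s, rfl⟩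
    -- injectivity: `X_i → X` injective and `X_i ⊗_{A₀} D₀` flat over `X_i`
    have hincl : Function.Injective (algebraMap (Xf i) X) := fun a b h => by
      apply Subtype.ext
      have h' := congrArg Subtype.val h
      exact h'
    have hinj : Function.Injective φ := fun a b hab =>
      Algebra.TensorProduct.includeLeft_injective (R := Xf i) (A := Xf i ⊗[A₀] D₀) (B := X)
        (S := Xf i) hincl (ψ.injective hab)
    refine ⟨?_, Xf i ⊗[A₀] D₀, inferInstance, inferInstance, inferInstance, φ.toRingHom, hinj,
      hrange, RingHom.ext fun r => φ.commutes r⟩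
    -- `E_i` is integrally closed in `D ≅ (X_i ⊗_{A₀} D₀) ⊗_{X_i} X`
    intro d hd
    let φE : (Xf i ⊗[A₀] D₀) →+* E i :=
      φ.toRingHom.codRestrict _ hmemφ
    have hφE : Function.Surjective φE := by
      rintro ⟨d', hd'⟩
      have : d' ∈ φ.toRingHom.range := by rw [hrange]; exact hd'
      obtain ⟨s, hs⟩ := this
      exact ⟨s, Subtype.ext hs⟩
    letI : Algebra (Xf i ⊗[A₀] D₀) (E i) := φE.toAlgebra
    letI : Algebra (Xf i ⊗[A₀] D₀) D := φ.toRingHom.toAlgebra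
    haveI : IsScalarTower (Xf i ⊗[A₀] D₀) (E i) D :=
      IsScalarTower.of_algebraMap_eq (fun _ => rfl)
    haveI : Algebra.IsIntegral (Xf i ⊗[A₀] D₀) (E i) :=
      Algebra.isIntegral_of_surjective hφE
    have hdS : IsIntegral (Xf i ⊗[A₀] D₀) d := isIntegral_trans d hd
    have hdT : IsIntegral (Xf i ⊗[A₀] D₀) (ψ.symm d) := by
      refine IsIntegral.map_of_comp_eq (R := Xf i ⊗[A₀] D₀) (S := D) (T := Xf i ⊗[A₀] D₀)
        (U := (Xf i ⊗[A₀] D₀) ⊗[Xf i] X) (RingHom.id _) ψ.symm.toAlgHom.toRingHom ?_ hdS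
      refine RingHom.ext fun s => ?_
      change s ⊗ₜ[Xf i] (1 : X) = ψ.symm (ψ (s ⊗ₜ[Xf i] (1 : X)))
      rw [AlgEquiv.symm_apply_apply]
    have hRB : ∀ b : X, IsIntegral (Xf i) b → ∃ r : Xf i, algebraMap (Xf i) X r = b := by
      intro b hb
      have hb' : IsIntegral (Xf i) (b : K) := hb.map (IsScalarTower.toAlgHom (Xf i) X K)
      exact ⟨⟨b, hic i b hb'⟩, Subtype.ext rfl⟩
    obtain ⟨s, hs⟩ := tmul_one_of_isIntegral (R := Xf i) (S := Xf i ⊗[A₀] D₀) (B := X) hRB hdT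
    have : d = φ s := by
      rw [← ψ.apply_symm_apply d, ← hs]
      rfl
    rw [this]
    exact hmemφ s
  exact ⟨i₁, F, E, fun i => rfl, fun i j hij => hEmono hij, hcovE, fun i hi => (main i hi).1,
    fun i hi => (main i hi).2⟩

end osc

/-! ### The `η`-models of §2.3 as a directed union -/

section etaModels

variable {κ K : Type u} [Field κ] [Field K] [Algebra κ K]
  {ι : Type*} [Preorder ι] [IsDirectedOrder ι] [Nonempty ι]

/-- `X = Nr_K(C·R₀)` is the directed union of the `X_α = Nr_K(C·B_α)` when `R₀ ⊆ ⋃ B_α`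
(Temkin 2013, Prop. 2.3.8 (i): "The schemes `X` and `Y` are `S`-isomorphic to `proj lim X_α`
and `proj lim Y_α`", affine case). [cite: Temkin2013, Prop. 2.3.8 (i)] -/
theorem exists_mem_etaModel_of_directed (B : ι → Subring κ) (hBmono : Monotone B)
    (R₀ : Subring κ) (hR₀ : ∀ r ∈ R₀, ∃ i, r ∈ B i) (C : Subring K) {z : K}
    (hz : z ∈ etaModel κ C R₀) : ∃ i, z ∈ etaModel κ C (B i) := by
  have hTmono : Monotone (fun i => C ⊔ (B i).map (algebraMap κ K)) :=
    fun i j hij => sup_le_sup_left ((Subring.gc_map_comap _).monotone_l (hBmono hij)) C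
  refine exists_mem_nrIn_of_directed (fun i => C ⊔ (B i).map (algebraMap κ K)) hTmono
    (C ⊔ R₀.map (algebraMap κ K)) (fun w hw => ?_) hz
  rw [← Subring.mem_iSup_of_directed hTmono.directed_le]
  refine (sup_le ?_ ?_ : C ⊔ R₀.map (algebraMap κ K) ≤ ⨆ i, (C ⊔ (B i).map (algebraMap κ K))) hw
  · exact le_iSup_of_le (Classical.arbitrary ι) le_sup_left
  · rintro _ ⟨r, hr, rfl⟩
    obtain ⟨i, hi⟩ := hR₀ r hr
    exact le_iSup (fun i => C ⊔ (B i).map (algebraMap κ K)) i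
      (le_sup_right (b := (B i).map (algebraMap κ K)) ⟨r, hi, rfl⟩)

omit [Preorder ι] [IsDirectedOrder ι] [Nonempty ι] in
/-- `η`-models `Nr_K(C·B′)` are integrally closed in `K` (`Nr_K` is idempotent). [folklore] -/
theorem mem_etaModel_of_isIntegral (C : Subring K) (B' : Subring κ) {z : K}
    (hz : IsIntegral (etaModel κ C B') z) : z ∈ etaModel κ C B' := by
  change z ∈ nrIn _
  rw [← nrIn_nrIn]
  exact mem_nrIn_iff.mpr hz

omit [Preorder ι] [IsDirectedOrder ι] [Nonempty ι] in
/-- Absorption of a level model by an integrally closed subring of the cover: if `E ⊆ D` is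
integrally closed in `D` and contains the images of `B_α` and of the generators `s′` of
`C′ = B_{α₀}[s′]` (`α₀ ≤ α`), then it contains the image of `Y_α = Nr_M(C′·B_α)`, which is
integral over `C′·B_α`. [folklore] -/
theorem forall_mem_of_etaModel {M : Type u} [Field M] [Algebra κ M] (B : ι → Subring κ)
    {α₀ α : ι} (hα : B α₀ ≤ B α) (R₀ : Subring κ) (hBα : B α ≤ R₀) (C' : Subring M)
    (s' : Finset M) (hC' : C' = Subring.closure (↑((B α₀).map (algebraMap κ M)) ∪ ↑s'))
    {D : Type u} [CommRing D] (g : etaModel κ C' R₀ →+* D) (E : Subring D)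
    (hE : ∀ d, IsIntegral E d → d ∈ E)
    (hs' : ∀ c ∈ s', ∀ hc : c ∈ etaModel κ C' R₀, g ⟨c, hc⟩ ∈ E)
    (hBE : ∀ b : B α, g (etaModelBaseMap C' R₀ ⟨b, hBα b.2⟩) ∈ E)
    (y : etaModel κ C' (B α)) : g (Subring.inclusion (etaModel_mono C' hBα) y) ∈ E := by
  refine forall_mem_of_isIntegral_of_le (etaModel κ C' (B α)) (C' ⊔ (B α).map (algebraMap κ M))
    (le_nrIn _) (fun y hy => mem_nrIn_iff.mp hy)
    (g.comp (Subring.inclusion (etaModel_mono C' hBα))) E hE ?_ y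
  intro t ht
  have key : C' ⊔ (B α).map (algebraMap κ M) ≤
      (E.comap (g.comp (Subring.inclusion (etaModel_mono C' hBα)))).map
        (etaModel κ C' (B α)).subtype := by
    have hbmem : ∀ b ∈ B α, algebraMap κ M b ∈
        (E.comap (g.comp (Subring.inclusion (etaModel_mono C' hBα)))).map
          (etaModel κ C' (B α)).subtype := by
      intro b hb
      refine ⟨⟨algebraMap κ M b, map_le_etaModel C' (B α) ⟨b, hb, rfl⟩⟩, ?_, rfl⟩
      have h2 : Subring.inclusion (etaModel_mono C' hBα)
          ⟨algebraMap κ M b, map_le_etaModel C' (B α) ⟨b, hb, rfl⟩⟩ =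
          etaModelBaseMap C' R₀ ⟨b, hBα hb⟩ := Subtype.ext rfl
      change g (Subring.inclusion (etaModel_mono C' hBα) _) ∈ E
      rw [h2]
      exact hBE ⟨b, hb⟩
    refine sup_le (hC'.le.trans (Subring.closure_le.mpr ?_)) ?_
    · rintro m (⟨b, hb, rfl⟩ | hm)
      · exact hbmem b (hα hb)
      · have hmC' : m ∈ C' := hC'.ge (Subring.subset_closure (Or.inr hm))
        refine ⟨⟨m, le_etaModel C' (B α) hmC'⟩, ?_, rfl⟩
        exact hs' m hm _
    · rintro _ ⟨b, hb, rfl⟩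
      exact hbmem b hb
  obtain ⟨y', hy', hy'eq⟩ := key ht
  have : y' = ⟨t, le_nrIn _ ht⟩ := Subtype.ext hy'eq
  rw [← this]
  exact hy'

end etaModels

/-! ### Lemma 2.8.4, direction "⇒" -/

/-- DISCHARGE of the named fact `Temkin2013_Lemma284` (`InseparableLocalUniformizationLemmas.lean`):
**smooth-equivalence descends from `η`-normalized filtered projective limits** (Temkin 2013,
Lemma 2.8.4: "`(X, x)` and `(Y, y)` are smooth-equivalent over `S` if and only if there exists
`α₀ ∈ A` such that for each `α ≥ α₀` the germs `(X_α, x_α)` and `(Y_α, y_α)` are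
smooth-equivalent over `S_α`", direction "⇒", in the affine rendering of its use in §4). The
printed proof: "Find `z ∈ Z` and smooth morphisms `f : Z → Y` and `g : Z → X` as in definition
2.8.1. By Proposition 2.3.8, `f` and `g` come from smooth morphisms `f_α : Z_α → Y_α` and
`g_α : Z_α → X_α` for sufficiently large `α`, and it is obvious that `x_α` and `y_α` are the
images of the projection `z_α ∈ Z_α` of `z`." Formalized inside the given affine smooth cover
`Z = Spec D`: by `exists_levelSubring_smooth` (for `X = ⋃ X_α` and for `Y = ⋃ Y_α`), `D` is
exhausted by level subrings `E_α ≅ X_α ⊗ D₀`, resp. `E′_α ≅ Y_α ⊗ D₀′`, smooth over `X_α`,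
resp. `Y_α`, and integrally closed in `D`; for `α` large each absorbs the other's generators
and the image of the other model (`forall_mem_of_etaModel`; the two `R₀`-structures of `D`
agree), so `E_α = E′_α =: Z_α` is smooth over `X_α` and over `Y_α`, compatibly over `B_α`, and
`z_α = z ∩ Z_α` lies over `x_α` and `y_α`. The hypotheses "`B_{α₀}` Noetherian",
"`Frac B_α = κ`" and "`κ[C]`, `κ[C′]` integrally closed" of the fact are not used.
[cite: Temkin2013, Lemma 2.8.4 (with Prop. 2.3.8; arXiv:0804.1554v3 pp. 14–15, 31)] -/
theorem Temkin2013_Lemma284_holds : Temkin2013_Lemma284.{u} := by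
  intro ι _ _ α₀ hα₀ κ K M _ _ _ _ _ B hBmono _ _ R₀ hB hR₀ C s hC _ C' s' hC' _ x y hx hy hxy
  classical
  haveI : Nonempty ι := ⟨α₀⟩
  obtain ⟨D, _, _, _, hcomp, hXD, hYD, r, hr, hrx, hry⟩ := hxy
  -- the two one-sided constructions
  obtain ⟨i₁, F, E, hEdef, hEmono, hcovE, hicE, hsmE⟩ := exists_levelSubring_smooth
    (etaModel κ C R₀) (fun i => etaModel κ C (B i)) (fun i => etaModel_mono C (hB i)) D
    (fun i j hij => etaModel_mono C (hBmono hij))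
    (fun z hz => exists_mem_etaModel_of_directed B hBmono R₀ hR₀ C hz)
    (fun i z hz => mem_etaModel_of_isIntegral C (B i) hz)
  obtain ⟨i₁', F', E', hE'def, hE'mono, hcovE', hicE', hsmE'⟩ := exists_levelSubring_smooth
    (etaModel κ C' R₀) (fun i => etaModel κ C' (B i)) (fun i => etaModel_mono C' (hB i)) D
    (fun i j hij => etaModel_mono C' (hBmono hij))
    (fun z hz => exists_mem_etaModel_of_directed B hBmono R₀ hR₀ C' hz)
    (fun i z hz => mem_etaModel_of_isIntegral C' (B i) hz)
  -- the generators `s`, `s'` lie in the models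
  have hsX : ∀ c ∈ s, c ∈ etaModel κ C R₀ := fun c hc =>
    le_etaModel C R₀ (hC.ge (Subring.subset_closure (Or.inr hc)))
  have hs'Y : ∀ c ∈ s', c ∈ etaModel κ C' R₀ := fun c hc =>
    le_etaModel C' R₀ (hC'.ge (Subring.subset_closure (Or.inr hc)))
  -- levels absorbing the finitely many generators of the other side
  obtain ⟨j₁, hj₁⟩ := exists_forall_finset_of_directed (fun i (d : D) => d ∈ E i)
    (fun i j hij d hd => hEmono i j hij hd) F' (fun d _ => let ⟨i, _, hi⟩ := hcovE d; ⟨i, hi⟩)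
  obtain ⟨j₂, hj₂⟩ := exists_forall_finset_of_directed (fun i (d : D) => d ∈ E' i)
    (fun i j hij d hd => hE'mono i j hij hd) F (fun d _ => let ⟨i, _, hi⟩ := hcovE' d; ⟨i, hi⟩)
  obtain ⟨j₃, hj₃⟩ := exists_forall_finset_of_directed
    (fun i (c : M) => ∀ hc : c ∈ etaModel κ C' R₀, algebraMap (etaModel κ C' R₀) D ⟨c, hc⟩ ∈ E i)
    (fun i j hij c hc h => hEmono i j hij (hc h)) s'
    (fun c hc => let ⟨i, _, hi⟩ := hcovE (algebraMap (etaModel κ C' R₀) D ⟨c, hs'Y c hc⟩);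
      ⟨i, fun _ => hi⟩)
  obtain ⟨j₄, hj₄⟩ := exists_forall_finset_of_directed
    (fun i (c : K) => ∀ hc : c ∈ etaModel κ C R₀, algebraMap (etaModel κ C R₀) D ⟨c, hc⟩ ∈ E' i)
    (fun i j hij c hc h => hE'mono i j hij (hc h)) s
    (fun c hc => let ⟨i, _, hi⟩ := hcovE' (algebraMap (etaModel κ C R₀) D ⟨c, hsX c hc⟩);
      ⟨i, fun _ => hi⟩)
  obtain ⟨α₁, hα₁⟩ := ({i₁, i₁', j₁, j₂, j₃, j₄} : Finset ι).exists_le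
  refine ⟨α₁, fun α hα => ?_⟩
  have hi₁ : i₁ ≤ α := (hα₁ i₁ (by simp)).trans hα
  have hi₁' : i₁' ≤ α := (hα₁ i₁' (by simp)).trans hα
  have hj₁α : j₁ ≤ α := (hα₁ j₁ (by simp)).trans hα
  have hj₂α : j₂ ≤ α := (hα₁ j₂ (by simp)).trans hα
  have hj₃α : j₃ ≤ α := (hα₁ j₃ (by simp)).trans hα
  have hj₄α : j₄ ≤ α := (hα₁ j₄ (by simp)).trans hα
  -- the base `B_α` maps into both level subrings through the common `R₀`-structure
  have hBX : ∀ b : B α,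
      algebraMap (etaModel κ C R₀) D (etaModelBaseMap C R₀ ⟨b, hB α b.2⟩) ∈ E α := by
    intro b
    have h2 : etaModelBaseMap C R₀ ⟨b, hB α b.2⟩ = Subring.inclusion (etaModel_mono C (hB α))
        ⟨algebraMap κ K b, map_le_etaModel C (B α) ⟨b, b.2, rfl⟩⟩ := Subtype.ext rfl
    rw [h2, hEdef]
    exact Subring.subset_closure (Or.inl ⟨_, rfl⟩)
  have hBY : ∀ b : B α,
      algebraMap (etaModel κ C' R₀) D (etaModelBaseMap C' R₀ ⟨b, hB α b.2⟩) ∈ E' α := by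
    intro b
    have h2 : etaModelBaseMap C' R₀ ⟨b, hB α b.2⟩ = Subring.inclusion (etaModel_mono C' (hB α))
        ⟨algebraMap κ M b, map_le_etaModel C' (B α) ⟨b, b.2, rfl⟩⟩ := Subtype.ext rfl
    rw [h2, hE'def]
    exact Subring.subset_closure (Or.inl ⟨_, rfl⟩)
  have hcompb : ∀ b : B α,
      algebraMap (etaModel κ C R₀) D (etaModelBaseMap C R₀ ⟨b, hB α b.2⟩) =
        algebraMap (etaModel κ C' R₀) D (etaModelBaseMap C' R₀ ⟨b, hB α b.2⟩) :=
    fun b => RingHom.congr_fun hcomp ⟨b, hB α b.2⟩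
  -- the images of `Y_α` in `E_α` and of `X_α` in `E'_α`
  have hYE : ∀ y' : etaModel κ C' (B α), algebraMap (etaModel κ C' R₀) D
      (Subring.inclusion (etaModel_mono C' (hB α)) y') ∈ E α :=
    forall_mem_of_etaModel B (hBmono (hα₀ α)) R₀ (hB α) C' s' hC' (algebraMap _ D) (E α)
      (hicE α hi₁) (fun c hc hcY => hEmono _ _ hj₃α (hj₃ c hc hcY))
      (fun b => (hcompb b) ▸ hBX b)
  have hXE' : ∀ x' : etaModel κ C (B α), algebraMap (etaModel κ C R₀) D
      (Subring.inclusion (etaModel_mono C (hB α)) x') ∈ E' α :=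
    forall_mem_of_etaModel B (hBmono (hα₀ α)) R₀ (hB α) C s hC (algebraMap _ D) (E' α)
      (hicE' α hi₁') (fun c hc hcX => hE'mono _ _ hj₄α (hj₄ c hc hcX))
      (fun b => (hcompb b).symm ▸ hBY b)
  -- hence `E_α = E'_α`
  have hE'E : E' α ≤ E α := by
    rw [hE'def]
    refine Subring.closure_le.mpr ?_
    rintro d (⟨y', rfl⟩ | hd)
    · exact hYE y'
    · exact hEmono _ _ hj₁α (hj₁ d hd)
  have hEE' : E α ≤ E' α := by
    rw [hEdef]
    refine Subring.closure_le.mpr ?_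
    rintro d (⟨x', rfl⟩ | hd)
    · exact hXE' x'
    · exact hE'mono _ _ hj₂α (hj₂ d hd)
  have heq : E α = E' α := le_antisymm hEE' hE'E
  -- the two smooth structures on `Z_α = Spec E_α`
  obtain ⟨S, _, _, _, φ, hφinj, hφrange, hφcomp⟩ := hsmE α hi₁
  obtain ⟨instX, hX, smX⟩ := exists_algebra_smooth_of_range
    ((algebraMap (etaModel κ C R₀) D).comp (Subring.inclusion (etaModel_mono C (hB α))))
    φ hφinj hφcomp (E α) hφrange
  obtain ⟨S', _, _, _, φ', hφ'inj, hφ'range, hφ'comp⟩ := hsmE' α hi₁'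
  obtain ⟨instY, hY, smY⟩ := exists_algebra_smooth_of_range
    ((algebraMap (etaModel κ C' R₀) D).comp (Subring.inclusion (etaModel_mono C' (hB α))))
    φ' hφ'inj hφ'comp (E α) (hφ'range.trans heq.symm)
  refine ⟨E α, inferInstance, instX, instY, ?_, smX, smY, r.comap (E α).subtype,
    Ideal.comap_isPrime _ _, ?_, ?_⟩
  · -- the `B_α`-structures agree (checked inside `D`)
    ext b
    change (((algebraMap (etaModel κ C (B α)) (E α)) (etaModelBaseMap C (B α) b) : E α) : D) =
      (((algebraMap (etaModel κ C' (B α)) (E α)) (etaModelBaseMap C' (B α) b) : E α) : D)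
    rw [hX, hY, RingHom.comp_apply, RingHom.comp_apply]
    have h1 : Subring.inclusion (etaModel_mono C (hB α)) (etaModelBaseMap C (B α) b) =
        etaModelBaseMap C R₀ ⟨b, hB α b.2⟩ := Subtype.ext rfl
    have h2 : Subring.inclusion (etaModel_mono C' (hB α)) (etaModelBaseMap C' (B α) b) =
        etaModelBaseMap C' R₀ ⟨b, hB α b.2⟩ := Subtype.ext rfl
    rw [h1, h2]
    exact hcompb b
  · -- `z_α` lies over `x_α`
    rw [Ideal.comap_comap, show (E α).subtype.comp (algebraMap (etaModel κ C (B α)) (E α)) =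
        (algebraMap (etaModel κ C R₀) D).comp (Subring.inclusion (etaModel_mono C (hB α))) from
      RingHom.ext hX, ← Ideal.comap_comap, hrx]
  · -- `z_α` lies over `y_α`
    rw [Ideal.comap_comap, show (E α).subtype.comp (algebraMap (etaModel κ C' (B α)) (E α)) =
        (algebraMap (etaModel κ C' R₀) D).comp (Subring.inclusion (etaModel_mono C' (hB α))) from
      RingHom.ext hY, ← Ideal.comap_comap, hry]

end Literature.AlgebraicGeometry.Resolution
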